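import Summits.PneNP.PneNP.Theorems.ChebyshevTracialDesignCrossingPlaneUnconditional
import Summits.PneNP.PneNP.Theorems.ChebyshevTracialDesignBlockStatisticPricingByType
import Literature.Combinatorics.Optimization.ShellLawAtypicalChernoff
import HarnessLib

/-!
# Cell pnp-psdrank, route `ChebyshevTracialDesign`: (CG_1′) IN THE CROSSING PLANE WITH THE `x`-SMOOTHNESS
# REMAINDERS DISCHARGED BY THE `H`-TYPE OF THE MATCHING — brick 125 (crux `TracialDecayExp20`, stmt-PneNP-19878)

Brick 125 (prover g25; MEMO-25 §5 (1) «brick 120b», MEMO-27 §4 (a)). Brick 124 (`crossingPlane_value_le`) bounds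
the tilted (CG_1′) value of a nonnegative block statistic in every crossing-plane direction, per NON-ALIGNED
matching `M`, by brick 120's seven pure remainders — built from ONE uniform `x`-smoothness family `X_k` of the
shell laws of `M`'s ground sets with `e ≤ 2` pinned and `2k` deleted edges (`k ≤ D+1`, levels `c′ + 2k ≤ T`,
cut `t − e − 2k`) — plus the [TAIL] term, unconditionally in `n ≥ n₀(β, K)`. The family `X` is a HYPOTHESIS
there. This file DISCHARGES it from the `H`-type `(a, b, d)` of `M` exactly as brick 118/118b did for brick 117,
with two differences: (i) the deleted ground sets have `2k + e ≤ 2(D+2)` missing edges and arbitrary levels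
`c′ ≤ T` of either parity (wrong parity / too high level = EMPTY shell, zero law: §1); (ii) the atypical
hypergeometric weight is priced by the CHERNOFF bound of Literature `ShellLawAtypicalChernoff`
(`sum_abs_nab2_iter_shellLaw_le_exp`) instead of the factorial-moment tail, so a CONSTANT type margin `β`
works for every balanced cut `t` (the moment tail needed `β ≍ 1/log n`, brick 118c).

* §1 `shellIn_eq_empty_of_not_even` (a cut has `|U| = |half U| + 2·#full edges`), `sum_abs_nab2_iter_eq_zero_of_empty`.
* §2 `type_margins_of_deleted₂` — the six margins of `smoothnessNumber_le_of_type` / `hypVar_component_ge` for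
  every `π`-stable `S′` with `|S′| + 2j = n`, `j ≤ 2(D+2)`, level `c′ ≤ T`, `s ≤ t/2`, from four margins on the
  type of `M` (brick 118's, with `D+2` for `D+1`).
* §3 `exponent_mono` (the Chernoff exponent is monotone in `s ∈ [(t−T−2)/2, t/2]`, `a′ ≤ a`, `N″ ≥ n/2 − T − 2`),
  **`smoothnessFamily_le_of_type`** — THE DISCHARGE: for every `k ≤ D+1`, `e ≤ 2`, `c′ + 2k ≤ T` and
  `π`-stable `S′` with `|S′| + 4k + 2e = n`:
  `Σ_{x=0}^{t−e} |(∇²)^k law_{S′}(t−e−2k,·)(c′)(x)| ≤ (2√192·√(4k/V₀))^{2k} + 4^k·exp(E₀)`,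
  `E₀ = (u+u²)·(t/2)·a/(n/2−T−2) − u·((t−T−2)/2 + 1 − r₀)` (`a` = number of `HH` edges of `M`).
* §4 **`crossingPlane_value_le_of_type`** — BRICK 124 WITH `X` DISCHARGED: for every `β > 0`, `K ≥ 0` there
  is `n₀` such that for `n ≥ n₀`, every balanced exact design as in brick 124, every `M, H` with brick 124's
  margins AND brick 118's four type margins (parameters `β₁, V₀, r₀, u`), every `0 ≤ ψ ≤ G`, `|λ|,|κ| ≤ 1`,
  `m`, and every `X` with `X_k ≥ (2√192·√(4k/V₀))^{2k} + 4^k·exp(E₀)` (`k ≤ D+1`): brick 124's conclusion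
  holds with that `X` — NO smoothness hypothesis is left; the only inputs are the type of `M` and numbers.
READING: with `V₀ ≍ β⁴n`, `r₀ ≍ βn`, `u` a small constant, `E₀ ≤ −c(β)·n`, so `X_{D±1}, X_D ≲ (C D/(β⁴ n))^{D−1}
+ 4^{D+1}e^{−c n}` and the seven remainders are `≤ poly(n)·e^{−a′D}` for `n ≥ n₀(β,a′)` (brick 126). WHAT THIS
FILE DOES NOT DO: the asymptotic bookkeeping (brick 126), the average over `M` (brick 127), directions outside the
crossing plane ((O3)); anything on `TracialDecayExp20` itself, psd rank of P_PM(K_n), or P vs NP.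
[cite: Rothvoss2017, §2 (PDF pp. 5–6)] [cite: RollinRoss2010, §3 Lemma 3.3; §4.1 Thm 4.2] [cite: Durrett2019, §2.7]
Stature: support/instrument (kernel lane, no defs, axioms standard). Supports stmt-PneNP-19878.
-/

set_option linter.dupNamespace false -- `Summit.PneNP.PneNP.…`: summit = sub-problem (D-0017)

noncomputable section

namespace Summit.PneNP.PneNP.Theorems.ChebyshevTracialDesignCrossingPlaneByType

open Finset Polynomial Literature.Barriers.PneNP Literature.Combinatorics.Optimization
open Literature.Combinatorics.Optimization.ShellStep
open Summit.PneNP.PneNP.Theorems.ChebyshevTracialDesignCrossingPlaneUnconditional (crossingPlane_value_le)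

variable {n : ℕ}

/-! ### §1 Empty shells: wrong parity -/

/-- A cut `U` has `|U| = |half U| + |full U|` with `|full U|` even (the full vertices are a union of edges), so
`Shell_S(t,c) = ∅` unless `t + c` is even. [cite: Rothvoss2017, §2 (PDF p. 6)] -/
theorem shellIn_eq_empty_of_not_even {π : Fin n → Fin n} (hπ : ∀ v, π (π v) = v) (hπ' : ∀ v, π v ≠ v)
    (S : Finset (Fin n)) {t c : ℕ} (h : ¬ Even (t + c)) : shellIn π S t c = ∅ := by
  refine filter_eq_empty_iff.2 fun U _ hU => ?_
  have h1 := card_full_add_card_half (π := π) U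
  have h2 := two_mul_card_reps hπ hπ' (full_stable hπ U)
  exact h ⟨(reps π (full π U)).card + c, by omega⟩

/-- For an empty shell every `x`-smoothness number vanishes: `Σ_{x∈win} |(∇²)^k law_S(t,·)(c)(x)| = 0`.
[cite: Rothvoss2017, §2 (PDF p. 6)] -/
theorem sum_abs_nab2_iter_eq_zero_of_empty {π : Fin n → Fin n} {S : Finset (Fin n)} (H : Finset (Fin n))
    {t c : ℕ} (h : shellIn π S t c = ∅) (k : ℕ) (win : Finset ℤ) :
    ∑ x ∈ win, |nab2^[k] (fun c' x => shellLaw π S H t c' x : Profile) c x| = 0 := by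
  have hz : (fun c' x => shellLaw π S H t c' x : Profile) c = (0 : Profile) c := by
    funext x
    simp only [shellLaw, h, card_empty, Nat.cast_zero, div_zero, Pi.zero_apply]
  have hk : nab2^[k] (fun c' x => shellLaw π S H t c' x : Profile) c = nab2^[k] (0 : Profile) c :=
    nab2_iter_apply_congr k hz
  have h0 : nab2^[k] (0 : Profile) = 0 := Function.iterate_fixed nab2_zero k
  refine sum_eq_zero fun x _ => ?_
  rw [hk, h0]
  simp

/-! ### §2 Type margins of the ground sets with `j ≤ 2(D+2)` deleted edges -/

/-- **Type margins of the deleted/pinned ground sets from the type of the matching.** If `S′` is `π`-stable with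
`|S′| + 2j = n`, `j ≤ 2(D+2)`, the level `c ≤ T` and `s ≤ t/2`, then brick 118's four margins of `M`'s type
(`b` mixed, `d` `H̄H̄` edges, with `D+2` in place of `D+1`) give the six margins of `hypVar_component_ge` for `S′`.
[cite: Rothvoss2017, §2 (PDF p. 5)] -/
theorem type_margins_of_deleted₂ {π : Fin n → Fin n} (hπ : ∀ v, π (π v) = v) (hπ' : ∀ v, π v ≠ v)
    (H : Finset (Fin n)) {S' : Finset (Fin n)} (hS' : ∀ v ∈ S', π v ∈ S') {j D T c s t : ℕ}
    (hcard : S'.card + 2 * j = n) (hjD : j ≤ 2 * (D + 2)) (hcT : c ≤ T) (hst : 2 * s ≤ t) {β V₀ : ℝ} (hβ : 0 < β)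
    (r₀ : ℕ)
    (hbT : β * (((reps π (vBH π univ H ∪ vBN π univ H)).card : ℝ) + (reps π (vDD π univ H)).card) + T + 2 * (D + 2) ≤
      (reps π (vBH π univ H ∪ vBN π univ H)).card)
    (hdT : β * (((reps π (vBH π univ H ∪ vBN π univ H)).card : ℝ) + (reps π (vDD π univ H)).card) + T + 2 * (D + 2) ≤
      (reps π (vDD π univ H)).card)
    (hr₀ : β * (((reps π (vBH π univ H ∪ vBN π univ H)).card : ℝ) + (reps π (vDD π univ H)).card) ≤ r₀)
    (hsT : (t : ℝ) / 2 + β * (((reps π (vBH π univ H ∪ vBN π univ H)).card : ℝ) + (reps π (vDD π univ H)).card) +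
      2 * T + 4 * (D + 2) + 2 ≤ ((reps π (vBH π univ H ∪ vBN π univ H)).card : ℝ) + (reps π (vDD π univ H)).card)
    (hV₀le : V₀ ≤ β ^ 4 * ((((reps π (vBH π univ H ∪ vBN π univ H)).card : ℝ) + (reps π (vDD π univ H)).card) -
      4 * (D + 2) - 2 * T)) :
    V₀ ≤ β ^ 4 * ((((reps π (vBH π S' H ∪ vBN π S' H)).card : ℝ) + (reps π (vDD π S' H)).card) - 2 * c) ∧
    β * (((reps π (vBH π S' H ∪ vBN π S' H)).card : ℝ) + (reps π (vDD π S' H)).card) + c ≤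
      (reps π (vBH π S' H ∪ vBN π S' H)).card ∧
    β * (((reps π (vBH π S' H ∪ vBN π S' H)).card : ℝ) + (reps π (vDD π S' H)).card) + c ≤
      (reps π (vDD π S' H)).card ∧
    β * (((reps π (vBH π S' H ∪ vBN π S' H)).card : ℝ) + (reps π (vDD π S' H)).card) ≤ r₀ ∧
    (s : ℝ) + β * (((reps π (vBH π S' H ∪ vBN π S' H)).card : ℝ) + (reps π (vDD π S' H)).card) + 2 * c ≤
      ((reps π (vBH π S' H ∪ vBN π S' H)).card : ℝ) + (reps π (vDD π S' H)).card ∧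
    2 + 2 * c ≤ (reps π (vBH π S' H ∪ vBN π S' H)).card + (reps π (vDD π S' H)).card := by
  set b := (reps π (vBH π univ H ∪ vBN π univ H)).card with hbdef
  set d := (reps π (vDD π univ H)).card with hddef
  set b' := (reps π (vBH π S' H ∪ vBN π S' H)).card with hb'def
  set d' := (reps π (vDD π S' H)).card with hd'def
  obtain ⟨_, hbge, hdge⟩ := two_mul_reps_le_of_subset hπ hπ' (S := univ) (S' := S') (fun v _ => mem_univ _) hS' H
  obtain ⟨_, hble, hdle⟩ := reps_card_le_of_subset (π := π) (S := univ) (S' := S') (subset_univ _) H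
  rw [← hbdef, ← hb'def] at hbge hble
  rw [← hddef, ← hd'def] at hdge hdle
  have hdiff : (univ \ S').card = 2 * j := by
    rw [card_sdiff, inter_eq_left.2 (subset_univ _), card_univ, Fintype.card_fin]; omega
  rw [hdiff] at hbge hdge
  have hbge' : (b : ℝ) ≤ b' + 2 * (D + 2) := by
    have : b ≤ b' + 2 * (D + 2) := by omega
    exact_mod_cast this
  have hdge' : (d : ℝ) ≤ d' + 2 * (D + 2) := by
    have : d ≤ d' + 2 * (D + 2) := by omega
    exact_mod_cast this
  have hble' : (b' : ℝ) ≤ b := by exact_mod_cast hble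
  have hdle' : (d' : ℝ) ≤ d := by exact_mod_cast hdle
  have hcT' : (c : ℝ) ≤ T := by exact_mod_cast hcT
  have hst' : (s : ℝ) ≤ (t : ℝ) / 2 := by
    have : ((2 * s : ℕ) : ℝ) ≤ t := by exact_mod_cast hst
    push_cast at this; linarith
  have hβm : β * ((b' : ℝ) + d') ≤ β * ((b : ℝ) + d) := mul_le_mul_of_nonneg_left (by linarith) hβ.le
  have hβ4 : 0 ≤ β ^ 4 := by positivity
  refine ⟨?_, by linarith, by linarith, by linarith, by linarith, ?_⟩
  · exact hV₀le.trans (mul_le_mul_of_nonneg_left (by linarith) hβ4)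
  · have : (2 : ℝ) + 2 * c ≤ (b' : ℝ) + d' := by
      have hβbd : 0 ≤ β * ((b : ℝ) + d) := by positivity
      have ht0 : (0 : ℝ) ≤ (t : ℝ) / 2 := by positivity
      linarith
    exact_mod_cast this

/-! ### §3 The discharge of brick 124's `x`-smoothness family -/

/-- The Chernoff exponent `(u+u²)·s·a′/N″ − u·(s+1−r₀)` is at most `(u+u²)·(t/2)·a/(n/2−T−2) − u·((t−T−2)/2+1−r₀)`
for `(t−T−2)/2 ≤ s ≤ t/2`, `a′ ≤ a`, `0 < n/2 − T − 2 ≤ N″`, `0 ≤ u`. [cite: Durrett2019, §2.7] -/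
theorem exponent_mono {u s a' a N'' t T nh r₀ : ℝ} (hu : 0 ≤ u) (hs0 : 0 ≤ s) (hs : s ≤ t / 2)
    (hs' : (t - T - 2) / 2 ≤ s) (ha0 : 0 ≤ a') (ha : a' ≤ a) (hN0 : 0 < nh - T - 2) (hN : nh - T - 2 ≤ N'') :
    (u + u ^ 2) * (s * a' / N'') - u * (s + 1 - r₀) ≤
      (u + u ^ 2) * (t / 2 * a / (nh - T - 2)) - u * ((t - T - 2) / 2 + 1 - r₀) := by
  have huu : 0 ≤ u + u ^ 2 := by positivity
  have hN''0 : 0 < N'' := lt_of_lt_of_le hN0 hN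
  have h1 : s * a' / N'' ≤ t / 2 * a / (nh - T - 2) := by
    rw [div_le_div_iff₀ hN''0 hN0]
    have e1 : s * a' * (nh - T - 2) ≤ s * a' * N'' := mul_le_mul_of_nonneg_left hN (mul_nonneg hs0 ha0)
    have e2 : s * a' ≤ t / 2 * a := mul_le_mul hs ha ha0 (by linarith)
    have e3 : s * a' * N'' ≤ t / 2 * a * N'' := mul_le_mul_of_nonneg_right e2 hN''0.le
    linarith
  have h2 : u * ((t - T - 2) / 2 + 1 - r₀) ≤ u * (s + 1 - r₀) := mul_le_mul_of_nonneg_left (by linarith) hu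
  nlinarith [mul_le_mul_of_nonneg_left h1 huu]

/-- **THE DISCHARGE of brick 124's uniform `x`-smoothness family from the `H`-type of the matching.** For a perfect
matching `M` (partner map `π`), a block `H`, a cut size `t` and top level `T` with `t + T + 2 ≤ n`, `T + 2 < n/2`,
parameters `β > 0`, `V₀ > 0` (`2(D+1) − 1 ≤ 2V₀`), `u ∈ [0,1]`, `r₀`, and brick 118's four margins on the type of `M`
(with `D+2` for `D+1`): for every `k ≤ D+1`, `e ≤ 2`, level `c′` with `c′ + 2k ≤ T` and every `π`-stable `S′` with
`|S′| + 4k + 2e = n`,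
`Σ_{x=0}^{t−e} |(∇²)^k law_{S′}(t−e−2k,·)(c′)(x)| ≤ (2√192·√(4k/V₀))^{2k} + 4^k·exp((u+u²)·(t/2)·a/(n/2−T−2) − u·((t−T−2)/2+1−r₀))`
(`a` = number of `HH` edges of `M`). Wrong parity or too high a level: empty shell (§1); otherwise
`ShellLawAtypicalChernoff.sum_abs_nab2_iter_shellLaw_le_exp` on the margins of §2 and `hypVar_component_ge`.
[cite: Rothvoss2017, §2 (PDF p. 6)] [cite: RollinRoss2010, §4.1 Thm 4.2] [cite: Durrett2019, §2.7] -/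
theorem smoothnessFamily_le_of_type (M : PMatch n) (H : Finset (Fin n)) {t T D : ℕ} (htn : t + T + 2 ≤ n)
    {β V₀ u : ℝ} (hβ : 0 < β) (hV₀ : 0 < V₀) (hu0 : 0 ≤ u) (hu1 : u ≤ 1) (r₀ : ℕ)
    (hkV : (2 * (D + 1 : ℕ) : ℝ) - 1 ≤ 2 * V₀)
    (hbT : β * (((reps M.2.partner (vBH M.2.partner univ H ∪ vBN M.2.partner univ H)).card : ℝ) +
      (reps M.2.partner (vDD M.2.partner univ H)).card) + T + 2 * (D + 2) ≤
      (reps M.2.partner (vBH M.2.partner univ H ∪ vBN M.2.partner univ H)).card)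
    (hdT : β * (((reps M.2.partner (vBH M.2.partner univ H ∪ vBN M.2.partner univ H)).card : ℝ) +
      (reps M.2.partner (vDD M.2.partner univ H)).card) + T + 2 * (D + 2) ≤
      (reps M.2.partner (vDD M.2.partner univ H)).card)
    (hr₀ : β * (((reps M.2.partner (vBH M.2.partner univ H ∪ vBN M.2.partner univ H)).card : ℝ) +
      (reps M.2.partner (vDD M.2.partner univ H)).card) ≤ r₀)
    (hsT : (t : ℝ) / 2 +
      β * (((reps M.2.partner (vBH M.2.partner univ H ∪ vBN M.2.partner univ H)).card : ℝ) +
        (reps M.2.partner (vDD M.2.partner univ H)).card) + 2 * T + 4 * (D + 2) + 2 ≤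
      ((reps M.2.partner (vBH M.2.partner univ H ∪ vBN M.2.partner univ H)).card : ℝ) +
        (reps M.2.partner (vDD M.2.partner univ H)).card)
    (hV₀le : V₀ ≤ β ^ 4 * ((((reps M.2.partner (vBH M.2.partner univ H ∪ vBN M.2.partner univ H)).card : ℝ) +
      (reps M.2.partner (vDD M.2.partner univ H)).card) - 4 * (D + 2) - 2 * T))
    (hNT : (T : ℝ) + 2 < (n : ℝ) / 2) :
    ∀ k, k ≤ D + 1 → ∀ e, e ≤ 2 → ∀ c' : ℕ, c' + 2 * k ≤ T → ∀ S' : Finset (Fin n), (∀ v ∈ S', M.2.partner v ∈ S') →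
      S'.card + 4 * k + 2 * e = n →
      ∑ x ∈ Icc (0 : ℤ) ((t - e : ℕ) : ℤ),
        |nab2^[k] (fun c x => shellLaw M.2.partner S' H (t - e - 2 * k) c x : Profile) c' x| ≤
      (2 * Real.sqrt 192 * Real.sqrt (4 * k / V₀)) ^ (2 * k) +
        (4 : ℝ) ^ k * Real.exp ((u + u ^ 2) * ((t : ℝ) / 2 * (reps M.2.partner (vAA M.2.partner univ H)).card /
            ((n : ℝ) / 2 - T - 2)) - u * (((t : ℝ) - T - 2) / 2 + 1 - r₀)) := by
  intro k hk e he c' hc' S' hS' hcard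
  set π := M.2.partner with hπdef
  have hπ : ∀ v, π (π v) = v := partner_partner M
  have hπ' : ∀ v, π v ≠ v := partner_ne M
  have hRHS : 0 ≤ (2 * Real.sqrt 192 * Real.sqrt (4 * k / V₀)) ^ (2 * k) +
      (4 : ℝ) ^ k * Real.exp ((u + u ^ 2) * ((t : ℝ) / 2 * (reps π (vAA π univ H)).card /
        ((n : ℝ) / 2 - T - 2)) - u * (((t : ℝ) - T - 2) / 2 + 1 - r₀)) := by positivity
  -- empty shells: too high a level, or wrong parity
  by_cases hlt : t - e - 2 * k < c'
  · rw [sum_abs_nab2_iter_eq_zero_of_empty H (shellIn_eq_empty_of_lt S' hlt)]; exact hRHS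
  by_cases hev : ¬ Even (t - e - 2 * k + c')
  · rw [sum_abs_nab2_iter_eq_zero_of_empty H (shellIn_eq_empty_of_not_even hπ hπ' S' hev)]; exact hRHS
  push Not at hlt hev
  obtain ⟨i, hi⟩ := hev
  obtain ⟨s, hs⟩ : ∃ s : ℕ, t - e - 2 * k = c' + 2 * s := ⟨i - c', by omega⟩
  rw [hs]
  -- the margins of `S′`
  have hj : S'.card + 2 * (2 * k + e) = n := by omega
  obtain ⟨h1, h2, h3, h4, h5, h6⟩ := type_margins_of_deleted₂ hπ hπ' H hS' hj (by omega) (show c' ≤ T by omega)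
    (t := t) (s := s) (by omega) hβ r₀ hbT hdT hr₀ hsT hV₀le
  have hV := hypVar_component_ge hπ hπ' hS' H c' s r₀ hβ h2 h3 h4 h5 h6
  have hkr : (2 * k : ℝ) - 1 ≤ 2 * V₀ := by
    have : (k : ℝ) ≤ (D + 1 : ℕ) := by exact_mod_cast hk
    push_cast at this hkV ⊢; linarith
  have hS'even := two_mul_card_reps hπ hπ' hS'
  have hsN : s ≤ S'.card / 2 - c' := by omega
  have h := sum_abs_nab2_iter_shellLaw_le_exp hπ hπ' hS' H c' s k r₀ (Icc (0 : ℤ) ((t - e : ℕ) : ℤ)) hV₀ hkr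
    (fun Y hY α hα hT => h1.trans (hV Y hY α hα hT)) hsN hu0 hu1
  refine h.trans (add_le_add le_rfl (mul_le_mul_of_nonneg_left (Real.exp_le_exp.2 ?_) (by positivity)))
  -- the exponent
  obtain ⟨hale, -, -⟩ := reps_card_le_of_subset (π := π) (S := univ) (S' := S') (subset_univ _) H
  have hR : (((S'.card / 2 - c' : ℕ) : ℝ)) = ((reps π S').card : ℝ) - c' := by
    have : c' ≤ (reps π S').card := by omega
    rw [show S'.card / 2 = (reps π S').card by omega, Nat.cast_sub this]
  refine exponent_mono hu0 (Nat.cast_nonneg _) ?_ ?_ (Nat.cast_nonneg _) (by exact_mod_cast hale) (by linarith) ?_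
  · have : ((c' + 2 * s : ℕ) : ℝ) ≤ t := by exact_mod_cast (show c' + 2 * s ≤ t by omega)
    push_cast at this; linarith
  · have : ((t : ℕ) : ℝ) ≤ ((T + 2 + 2 * s : ℕ) : ℝ) := by exact_mod_cast (show t ≤ T + 2 + 2 * s by omega)
    push_cast at this; linarith
  · rw [hR]
    have : ((n : ℕ) : ℝ) ≤ ((2 * (reps π S').card - 2 * c' + 2 * T + 4 : ℕ) : ℝ) := by
      exact_mod_cast (show n ≤ 2 * (reps π S').card - 2 * c' + 2 * T + 4 by omega)
    have hc'R : 2 * c' ≤ 2 * (reps π S').card := by omega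
    rw [Nat.cast_add, Nat.cast_add, Nat.cast_sub hc'R] at this
    push_cast at this
    linarith

/-! ### §4 Brick 124 with the `x`-smoothness family discharged -/

/-- **(CG_1′) IN THE CROSSING PLANE FOR NON-ALIGNED MATCHINGS, `X` DISCHARGED BY THE TYPE (brick 125).** For every
`β > 0` and `K ≥ 0` there is `n₀` such that for all `n ≥ n₀`: for every balanced exact design with
`t = t₁ + 2(D+1) + 2`, `n ≤ 4t`, `2D+1 ≤ T`, `1 ≤ D`, `D⁴ ≤ n`, every perfect matching `M` and block `H` with
brick 124's margins `β·n/2 + 2D + 1 ≤ a, b, d` AND brick 118's four type margins (parameter `β₁ > 0`, variance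
floor `V₀`, threshold `r₀`, Chernoff parameter `u ∈ [0,1]`, `T + 2 < n/2`), every `0 ≤ ψ ≤ G` on `[0,t]`,
`|λ|, |κ| ≤ 1`, `m ≥ 3` with `m + 4(D+1) + 4 ≤ n`, and every `X` dominating the explicit family
`(2√192·√(4k/V₀))^{2k} + 4^k·exp((u+u²)·(t/2)·a/(n/2−T−2) − u·((t−T−2)/2+1−r₀))`: brick 124's conclusion holds
with this `X` — no `x`-smoothness hypothesis remains. [cite: Rothvoss2017, §2 (PDF p. 6)]
[cite: RollinRoss2010, §3 Lemma 3.1, 3.3; §4.1 Thm 4.2] [cite: Durrett2019, §2.7] -/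
theorem crossingPlane_value_le_of_type {β K : ℝ} (hβ : 0 < β) (hK : 0 ≤ K) :
    ∃ n₀ : ℕ, ∀ n : ℕ, n₀ ≤ n → ∀ {t₁ T D : ℕ} {Bv : ℝ} {C : Finset ℕ} {w : ℕ → ℝ},
    IsExactDesign n (t₁ + 2 * (D + 1) + 2) T D Bv C w → 2 * D + 1 ≤ T → n ≤ 4 * (t₁ + 2 * (D + 1) + 2) →
    1 ≤ D → D ^ 4 ≤ n → ∀ (M : PMatch n) (H : Finset (Fin n)),
    β * n / 2 + 2 * D + 1 ≤ (reps M.2.partner (vAA M.2.partner univ H)).card →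
    β * n / 2 + 2 * D + 1 ≤ (reps M.2.partner (vBH M.2.partner univ H ∪ vBN M.2.partner univ H)).card →
    β * n / 2 + 2 * D + 1 ≤ (reps M.2.partner (vDD M.2.partner univ H)).card →
    ∀ (ψ : ℤ → ℝ) {G : ℝ}, 0 ≤ G →
    (∀ x ∈ Icc (0 : ℤ) ((t₁ + 2 * (D + 1) + 2 : ℕ) : ℤ), |ψ x| ≤ G) →
    ∀ (lam kap : ℝ), |lam| ≤ 1 → |kap| ≤ 1 →
    ∀ {m : ℕ}, 3 ≤ m → m + 4 * (D + 1) + 4 ≤ n →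
    ∀ {β₁ V₀ u : ℝ} {r₀ : ℕ}, 0 < β₁ → 0 < V₀ → 0 ≤ u → u ≤ 1 → (2 * (D + 1 : ℕ) : ℝ) - 1 ≤ 2 * V₀ →
    β₁ * (((reps M.2.partner (vBH M.2.partner univ H ∪ vBN M.2.partner univ H)).card : ℝ) +
      (reps M.2.partner (vDD M.2.partner univ H)).card) + T + 2 * (D + 2) ≤
      (reps M.2.partner (vBH M.2.partner univ H ∪ vBN M.2.partner univ H)).card →
    β₁ * (((reps M.2.partner (vBH M.2.partner univ H ∪ vBN M.2.partner univ H)).card : ℝ) +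
      (reps M.2.partner (vDD M.2.partner univ H)).card) + T + 2 * (D + 2) ≤
      (reps M.2.partner (vDD M.2.partner univ H)).card →
    β₁ * (((reps M.2.partner (vBH M.2.partner univ H ∪ vBN M.2.partner univ H)).card : ℝ) +
      (reps M.2.partner (vDD M.2.partner univ H)).card) ≤ r₀ →
    ((t₁ + 2 * (D + 1) + 2 : ℕ) : ℝ) / 2 +
      β₁ * (((reps M.2.partner (vBH M.2.partner univ H ∪ vBN M.2.partner univ H)).card : ℝ) +
        (reps M.2.partner (vDD M.2.partner univ H)).card) + 2 * T + 4 * (D + 2) + 2 ≤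
      ((reps M.2.partner (vBH M.2.partner univ H ∪ vBN M.2.partner univ H)).card : ℝ) +
        (reps M.2.partner (vDD M.2.partner univ H)).card →
    V₀ ≤ β₁ ^ 4 * ((((reps M.2.partner (vBH M.2.partner univ H ∪ vBN M.2.partner univ H)).card : ℝ) +
      (reps M.2.partner (vDD M.2.partner univ H)).card) - 4 * (D + 2) - 2 * T) →
    (T : ℝ) + 2 < (n : ℝ) / 2 →
    ∀ (X : ℕ → ℝ), (∀ k : ℕ, (2 * Real.sqrt 192 * Real.sqrt (4 * k / V₀)) ^ (2 * k) +
        (4 : ℝ) ^ k * Real.exp ((u + u ^ 2) * (((t₁ + 2 * (D + 1) + 2 : ℕ) : ℝ) / 2 *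
          (reps M.2.partner (vAA M.2.partner univ H)).card / ((n : ℝ) / 2 - T - 2)) -
          u * ((((t₁ + 2 * (D + 1) + 2 : ℕ) : ℝ) - T - 2) / 2 + 1 - r₀)) ≤ X k) →
    (∀ x ∈ Icc (0 : ℤ) ((t₁ + 2 * (D + 1) + 2 : ℕ) : ℤ), 0 ≤ ψ x) →
    (Fintype.card (PMatch n) : ℝ) * ∑ U : OddSet n, levelWeight n (t₁ + 2 * (D + 1) + 2) C w U M *
        (ψ ((U.1 ∩ H).card : ℤ) *
          (∑ p : Fin n, (lam * ((if (p ∈ H ∧ M.2.partner p ∈ H) then (1 : ℝ) else 0) -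
              (if (p ∉ H ∧ M.2.partner p ∉ H) then (1 : ℝ) else 0)) + (lam + kap)) *
            ((if p ∈ U.1 then (1 : ℝ) else 0) * (if M.2.partner p ∈ U.1 then (1 : ℝ) else 0))) ^ 2) ≤
      (Bv * ((((T - 1) / 2).choose (D + 1) : ℕ) : ℝ) *
          ((9 * ((t₁ + 2 * (D + 1) + 2 : ℕ) : ℝ) ^ 2 * G) * (((m : ℝ) / (4 * ((m : ℝ) - 2))) ^ (D + 1) * X (D + 1))) +
      2 * ((2 * (D : ℝ) + 1) * ((((2 * D).choose D : ℕ) : ℝ) / (4 : ℝ) ^ D) *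
            ((3 * ((t₁ + 2 * (D + 1) + 2 : ℕ) : ℝ) * G) * (((m : ℝ) / (4 * ((m : ℝ) - 2))) ^ D * X D)) +
          Bv * ((((T - 1) / 2).choose (D + 1) : ℕ) : ℝ) *
            ((T : ℝ) * ((3 * ((t₁ + 2 * (D + 1) + 2 : ℕ) : ℝ) * G) * (((m : ℝ) / (4 * ((m : ℝ) - 2))) ^ (D + 1) * X (D + 1))) +
              2 * ((D : ℝ) + 1) * ((3 * ((t₁ + 2 * (D + 1) + 2 : ℕ) : ℝ) * G) * (((m : ℝ) / (4 * ((m : ℝ) - 2))) ^ D * X D)))) +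
      ((2 * (D : ℝ) + 1) * ((((2 * D).choose D : ℕ) : ℝ) / (4 : ℝ) ^ D) *
          ((T : ℝ) * (G * (((m : ℝ) / (4 * ((m : ℝ) - 2))) ^ D * X D)) +
            2 * (D : ℝ) * (G * (((m : ℝ) / (4 * ((m : ℝ) - 2))) ^ (D - 1) * X (D - 1)))) +
        Bv * ((((T - 1) / 2).choose (D + 1) : ℕ) : ℝ) *
          ((T : ℝ) * ((T : ℝ) * (G * (((m : ℝ) / (4 * ((m : ℝ) - 2))) ^ (D + 1) * X (D + 1))) +
              2 * ((D : ℝ) + 1) * (G * (((m : ℝ) / (4 * ((m : ℝ) - 2))) ^ D * X D))) +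
            2 * ((D : ℝ) + 1) * ((T : ℝ) * (G * (((m : ℝ) / (4 * ((m : ℝ) - 2))) ^ D * X D)) +
              2 * (D : ℝ) * (G * (((m : ℝ) / (4 * ((m : ℝ) - 2))) ^ (D - 1) * X (D - 1)))))) +
      4 * ((2 * (D : ℝ) + 1) * ((((2 * D).choose D : ℕ) : ℝ) / (4 : ℝ) ^ D) *
            (((H.card : ℝ) / n) * ((3 * ((t₁ + 2 * (D + 1) + 2 : ℕ) : ℝ) * G) * (((m : ℝ) / (4 * ((m : ℝ) - 2))) ^ D * X D))) +
          Bv * ((((T - 1) / 2).choose (D + 1) : ℕ) : ℝ) *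
            ((T : ℝ) * (((H.card : ℝ) / n) * ((3 * ((t₁ + 2 * (D + 1) + 2 : ℕ) : ℝ) * G) *
                (((m : ℝ) / (4 * ((m : ℝ) - 2))) ^ (D + 1) * X (D + 1)))) +
              2 * ((D : ℝ) + 1) * (((H.card : ℝ) / n) * ((3 * ((t₁ + 2 * (D + 1) + 2 : ℕ) : ℝ) * G) *
                (((m : ℝ) / (4 * ((m : ℝ) - 2))) ^ D * X D))))) +
      4 * ((2 * (D : ℝ) + 1) * ((((2 * D).choose D : ℕ) : ℝ) / (4 : ℝ) ^ D) *
            ((T : ℝ) * (((H.card : ℝ) / n) * (G * (((m : ℝ) / (4 * ((m : ℝ) - 2))) ^ D * X D))) +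
              2 * (D : ℝ) * (((H.card : ℝ) / n) * (G * (((m : ℝ) / (4 * ((m : ℝ) - 2))) ^ (D - 1) * X (D - 1))))) +
          Bv * ((((T - 1) / 2).choose (D + 1) : ℕ) : ℝ) *
            ((T : ℝ) * ((T : ℝ) * (((H.card : ℝ) / n) * (G * (((m : ℝ) / (4 * ((m : ℝ) - 2))) ^ (D + 1) * X (D + 1)))) +
                2 * ((D : ℝ) + 1) * (((H.card : ℝ) / n) * (G * (((m : ℝ) / (4 * ((m : ℝ) - 2))) ^ D * X D)))) +
              2 * ((D : ℝ) + 1) * ((T : ℝ) * (((H.card : ℝ) / n) * (G * (((m : ℝ) / (4 * ((m : ℝ) - 2))) ^ D * X D))) +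
                2 * (D : ℝ) * (((H.card : ℝ) / n) * (G * (((m : ℝ) / (4 * ((m : ℝ) - 2))) ^ (D - 1) * X (D - 1))))))) +
      4 * ((2 * (D : ℝ) + 1) * ((((2 * D).choose D : ℕ) : ℝ) / (4 : ℝ) ^ D) *
            (((H.card : ℝ) / n) * (G * (((m : ℝ) / (4 * ((m : ℝ) - 2))) ^ D * X D))) +
          Bv * ((((T - 1) / 2).choose (D + 1) : ℕ) : ℝ) *
            ((T : ℝ) * (((H.card : ℝ) / n) * (G * (((m : ℝ) / (4 * ((m : ℝ) - 2))) ^ (D + 1) * X (D + 1)))) +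
              2 * ((D : ℝ) + 1) * (((H.card : ℝ) / n) * (G * (((m : ℝ) / (4 * ((m : ℝ) - 2))) ^ D * X D))))) +
      4 * ((2 * (D : ℝ) + 1) * ((((2 * D).choose D : ℕ) : ℝ) / (4 : ℝ) ^ D) *
            (((H.card : ℝ) ^ 2 / ((n : ℝ) * ((n : ℝ) - 2))) * (G * ((T : ℝ) * (((m : ℝ) / (4 * ((m : ℝ) - 2))) ^ D * X D) +
              2 * (D : ℝ) * (((m : ℝ) / (4 * ((m : ℝ) - 2))) ^ (D - 1) * X (D - 1))))) +
          Bv * ((((T - 1) / 2).choose (D + 1) : ℕ) : ℝ) *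
            ((T : ℝ) * (((H.card : ℝ) ^ 2 / ((n : ℝ) * ((n : ℝ) - 2))) *
                (G * ((T : ℝ) * (((m : ℝ) / (4 * ((m : ℝ) - 2))) ^ (D + 1) * X (D + 1)) +
                  2 * ((D : ℝ) + 1) * (((m : ℝ) / (4 * ((m : ℝ) - 2))) ^ D * X D)))) +
              2 * ((D : ℝ) + 1) * (((H.card : ℝ) ^ 2 / ((n : ℝ) * ((n : ℝ) - 2))) *
                (G * ((T : ℝ) * (((m : ℝ) / (4 * ((m : ℝ) - 2))) ^ D * X D) +
                  2 * (D : ℝ) * (((m : ℝ) / (4 * ((m : ℝ) - 2))) ^ (D - 1) * X (D - 1)))))))) +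
      (2 : ℝ) ^ (D + 1) * (9 * ((t₁ + 2 * (D + 1) + 2 : ℕ) : ℝ) ^ 2 * G) *
        (((D : ℝ) + 1) * (2 * ((n : ℝ) / 2 + 1) ^ 3 * Real.exp (-((K * Real.sqrt (H.card * D)) ^ 2 / H.card)))) := by
  obtain ⟨n₀, h124⟩ := crossingPlane_value_le hβ hK
  refine ⟨n₀, ?_⟩
  intro n hn t₁ T D Bv C w hdes hDT hbal hD1 hD4 M H haβ hbβ hdβ ψ G hG0 hG lam kap hlam hkap m hm hmn β₁ V₀ u r₀
    hβ₁ hV₀ hu0 hu1 hkV hbT hdT hr₀ hsT hV₀le hNT X hXge hψ0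
  have htn : (t₁ + 2 * (D + 1) + 2) + T + 2 ≤ n := by
    have h1 := hdes.2.1; have h2 := hdes.2.2.1; omega
  have hdis := smoothnessFamily_le_of_type M H (D := D) htn hβ₁ hV₀ hu0 hu1 r₀ hkV hbT hdT hr₀ hsT hV₀le hNT
  refine h124 n hn hdes hDT hbal hD1 hD4 M H haβ hbβ hdβ ψ hG0 hG lam kap hlam hkap hm hmn X
    (fun k => le_trans (by positivity) (hXge k)) ?_ hψ0
  intro k hk e he c' hc' S' hS' hcard
  exact (hdis k hk e he c' hc' S' hS' hcard).trans (hXge k)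

end Summit.PneNP.PneNP.Theorems.ChebyshevTracialDesignCrossingPlaneByType

end
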